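import Literature.Topology.PlaneTopology.WindingNumber
import Mathlib.Analysis.SpecialFunctions.Complex.Arg
import Mathlib.Topology.Algebra.Order.Floor
import HarnessLib

/-!
# Continuous logarithms on circles and annuli from a vanishing winding number

Topic: Topology / PlaneTopology.  A companion of `WindingNumber.lean` (Borsuk–Eilenberg continuous
logarithms, S. Eilenberg, Fund. Math. **26** (1936); A. Hatcher, *Algebraic Topology* (2002), §1.1
and Prop. 1.30): the converse direction of "a map with a logarithm does not wind" for the two sets
on which intersection-number computations read local indices.

* `continuous_fractExtension` — the `1`-periodic extension `l ∘ fract` of a continuous `l` on `[0, 1]`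
  with `l 0 = l 1` is continuous (Mathlib's `ContinuousOn.comp_fract`);
* `exists_int_arg_neg_div_add_half` — the two angle functions `arg u / 2π` and `arg (-u) / 2π + 1/2`
  differ by an integer (so a `1`-periodic function of the angle can be read through either; the
  second is continuous across the negative real axis);
* **`hasLogOn_sphere_of_wind_eq_zero`** — a continuous zero-free `q` on the circle `‖z - c‖ = ρ`
  (`ρ > 0`) whose loop `q ∘ circleLoop c ρ` has winding number `0` has a continuous logarithm on
  the circle (the periodic logarithm of the loop, `wind_eq_zero_iff`, descended along the angle);
* **`hasLogOn_annulus_of_wind_eq_zero`** — the same on the closed annulus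
  `r₁ ≤ ‖z - c‖ ≤ r₂` (`0 < r₁`) when the inner circle does not wind: the radial deformation onto
  the inner circle is a homotopy through zero-free maps (`hasLogOn_iff_of_homotopy`);
* `wind_conj` — `wind (conj ∘ f) = - wind f`; `wind_normSq` — `wind (|f|²) = 0`.

Everything here is proved; no definitions, no named facts.

## References
* S. Eilenberg, Transformations continues en circonférence et la topologie du plan, Fund. Math.
  26 (1936) 61–112. [Eilenberg1936]
* A. Hatcher, *Algebraic Topology*, CUP (2002), §1.1 (Thm. 1.7: `π₁(S¹) = ℤ` by path lifting)
  and Prop. 1.30. [HatcherAT2002]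
-/

noncomputable section

namespace Literature.Topology.PlaneTopology

open Complex Set _root_.Topology Filter Metric
open scoped Real ComplexConjugate

/-! ### Periodic extension and the two angle functions -/

/-- The `1`-periodic extension `x ↦ l (fract x)` of a continuous function on `[0, 1]` with equal
end values is continuous. [folklore] -/
theorem continuous_fractExtension {Y : Type*} [TopologicalSpace Y] {l : ℝ → Y}
    (hl : ContinuousOn l (Icc 0 1)) (h01 : l 0 = l 1) :
    Continuous fun x : ℝ => l (Int.fract x) := by
  have h : ContinuousOn (Function.uncurry fun (_ : ℝ) (x : ℝ) => l x) (univ ×ˢ Icc 0 1) :=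
    hl.comp continuous_snd.continuousOn fun p hp => hp.2
  exact ContinuousOn.comp_fract (s := id) h continuous_id fun _ => h01

/-- The `1`-periodic extension is `1`-periodic. [folklore] -/
theorem periodic_fractExtension {Y : Type*} (l : ℝ → Y) :
    Function.Periodic (fun x : ℝ => l (Int.fract x)) 1 := fun x => by
  simp only [Int.fract_add_one]

/-- **The two angle functions differ by an integer**: for `u ≠ 0`,
`arg (-u) / 2π + 1/2 = arg u / 2π + n` for some `n : ℤ`. [folklore] -/
theorem exists_int_arg_neg_div_add_half {u : ℂ} (hu : u ≠ 0) :
    ∃ n : ℤ, arg (-u) / (2 * π) + 1 / 2 = arg u / (2 * π) + n := by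
  have h := Complex.arg_neg_coe_angle hu
  rw [← Real.Angle.coe_add, Real.Angle.angle_eq_iff_two_pi_dvd_sub] at h
  obtain ⟨k, hk⟩ := h
  refine ⟨k + 1, ?_⟩
  have hπ : (2 * π : ℝ) ≠ 0 := by positivity
  field_simp
  push_cast
  linarith

/-- The angle function `z ↦ arg (z - c) / 2π` reproduces the point: for `‖z - c‖ = ρ`,
`circleLoop c ρ (fract (arg (z - c) / 2π)) = z`. [folklore] -/
theorem circleLoop_fract_arg {c z : ℂ} {ρ : ℝ} (hz : ‖z - c‖ = ρ) :
    circleLoop c ρ (Int.fract (arg (z - c) / (2 * π))) = z := by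
  rw [circleLoop_apply]
  have h1 : exp (2 * π * (Int.fract (arg (z - c) / (2 * π)) : ℝ) * I) = exp (arg (z - c) * I) := by
    rw [Int.fract, exp_eq_exp_iff_exists_int]
    refine ⟨-⌊arg (z - c) / (2 * π)⌋, ?_⟩
    push_cast
    have hπ : (2 * π : ℂ) ≠ 0 := by exact_mod_cast (by positivity : (2 * π : ℝ) ≠ 0)
    field_simp
    ring
  rw [h1, ← hz]
  have := norm_mul_exp_arg_mul_I (z - c)
  rw [this]
  ring

/-! ### Logarithms on a circle -/

/-- **A zero-free map on a circle whose loop does not wind has a continuous logarithm on the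
circle** (the periodic logarithm of `q ∘ circleLoop c ρ` given by `wind_eq_zero_iff`, read
through the angle `arg (z - c) / 2π`, and through `arg (-(z - c)) / 2π + 1/2` across the negative
real axis; Hatcher 2002, §1.1 Thm. 1.7 / Prop. 1.30). [cite: HatcherAT2002, §1.1 Thm. 1.7] -/
theorem hasLogOn_sphere_of_wind_eq_zero {q : ℂ → ℂ} {c : ℂ} {ρ : ℝ} (hρ : 0 < ρ)
    (hq : ContinuousOn q (sphere c ρ)) (hne : ∀ z ∈ sphere c ρ, q z ≠ 0)
    (hw : wind (fun t => q (circleLoop c ρ t)) = 0) : HasLogOn q (sphere c ρ) := by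
  have hloop : IsNonvanishingLoop fun t => q (circleLoop c ρ t) :=
    ⟨hq.comp (continuous_circleLoop c ρ).continuousOn fun t _ => circleLoop_mem_sphere c hρ.le t,
      fun t _ => hne _ (circleLoop_mem_sphere c hρ.le t), by simp only [circleLoop_zero_eq]⟩
  obtain ⟨l, hl, hle, h01⟩ := (wind_eq_zero_iff hloop).1 hw
  -- the periodic extension `L₀ = l ∘ fract` and the logarithm `L z = L₀ (arg (z - c) / 2π)`
  set L₀ : ℝ → ℂ := fun x => l (Int.fract x) with hL₀
  have hL₀c : Continuous L₀ := continuous_fractExtension hl h01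
  have hL₀p : Function.Periodic L₀ 1 := periodic_fractExtension l
  set L : ℂ → ℂ := fun z => L₀ (arg (z - c) / (2 * π)) with hL
  -- the second expression for `L`
  have hL' : ∀ z, z ≠ c → L z = L₀ (arg (-(z - c)) / (2 * π) + 1 / 2) := by
    intro z hz
    obtain ⟨n, hn⟩ := exists_int_arg_neg_div_add_half (sub_ne_zero.2 hz)
    rw [hn]
    have := hL₀p.int_mul n (arg (z - c) / (2 * π))
    rw [mul_one] at this
    exact this.symm
  refine ⟨L, fun z hz => ?_, fun z hz => ?_⟩
  · -- continuity at `z`, `‖z - c‖ = ρ`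
    have hzc : z ≠ c := by
      intro h
      rw [h, mem_sphere, dist_self] at hz
      exact hρ.ne' hz.symm
    apply ContinuousAt.continuousWithinAt
    by_cases hs : z - c ∈ slitPlane
    · have h1 : ContinuousAt (fun w : ℂ => arg (w - c) / (2 * π)) z :=
        ((continuousAt_arg hs).comp (f := fun w : ℂ => w - c)
          (continuousAt_id.sub continuousAt_const)).div_const _
      exact hL₀c.continuousAt.comp h1
    · -- across the negative real axis use the second expression
      have hs' : -(z - c) ∈ slitPlane := by
        rw [mem_slitPlane_iff, not_or, not_lt, not_ne_iff] at hs
        rw [mem_slitPlane_iff, neg_re, neg_pos]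
        refine Or.inl (lt_of_le_of_ne hs.1 fun h0 => hzc ?_)
        exact sub_eq_zero.1 (Complex.ext (by simpa using h0) (by simpa using hs.2))
      have hev : L =ᶠ[𝓝 z] fun w => L₀ (arg (-(w - c)) / (2 * π) + 1 / 2) := by
        filter_upwards [isOpen_ne.mem_nhds hzc] with w hw
        exact hL' w hw
      refine (ContinuousAt.congr ?_ hev.symm)
      have h1 : ContinuousAt (fun w : ℂ => arg (-(w - c)) / (2 * π) + 1 / 2) z :=
        (((continuousAt_arg hs').comp (f := fun w : ℂ => -(w - c))
          (continuousAt_id.sub continuousAt_const).neg).div_const _).add continuousAt_const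
      exact hL₀c.continuousAt.comp h1
  · -- `exp (L z) = q z`
    have hfr : Int.fract (arg (z - c) / (2 * π)) ∈ Icc (0 : ℝ) 1 :=
      ⟨Int.fract_nonneg _, (Int.fract_lt_one _).le⟩
    change exp (l (Int.fract (arg (z - c) / (2 * π)))) = q z
    rw [hle _ hfr, circleLoop_fract_arg (mem_sphere_iff_norm.1 hz)]

/-! ### Logarithms on a closed annulus -/

/-- **A zero-free map on a closed annulus `r₁ ≤ ‖z - c‖ ≤ r₂` (`0 < r₁`) whose inner loop does not
wind has a continuous logarithm on the annulus**: the radial deformation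
`H(s, z) = q (c + (1 - s + s r₁/‖z - c‖)(z - c))` is a homotopy through zero-free maps from `q` to
`q ∘ ret`, `ret` the radial retraction onto the inner circle, and `q ∘ ret` has the logarithm
`L ∘ ret` (`hasLogOn_sphere_of_wind_eq_zero`, `hasLogOn_iff_of_homotopy`).
[cite: HatcherAT2002, Prop. 1.30] -/
theorem hasLogOn_annulus_of_wind_eq_zero {q : ℂ → ℂ} {c : ℂ} {r₁ r₂ : ℝ} (hr₁ : 0 < r₁)
    (hq : ContinuousOn q {z : ℂ | r₁ ≤ ‖z - c‖ ∧ ‖z - c‖ ≤ r₂})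
    (hne : ∀ z : ℂ, r₁ ≤ ‖z - c‖ → ‖z - c‖ ≤ r₂ → q z ≠ 0)
    (hw : wind (fun t => q (circleLoop c r₁ t)) = 0) :
    HasLogOn q {z : ℂ | r₁ ≤ ‖z - c‖ ∧ ‖z - c‖ ≤ r₂} := by
  set A : Set ℂ := {z : ℂ | r₁ ≤ ‖z - c‖ ∧ ‖z - c‖ ≤ r₂} with hA
  rcases lt_or_ge r₂ r₁ with h21 | h12
  · have : A = ∅ := eq_empty_of_forall_notMem fun z hz => not_lt.2 (hz.1.trans hz.2) h21
    rw [this]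
    exact hasLogOn_empty q
  -- the radial factor `λ(s, z) = 1 - s + s r₁ / ‖z - c‖` and the homotopy
  set lam : ℝ → ℂ → ℝ := fun s z => 1 - s + s * (r₁ / ‖z - c‖) with hlam
  set H : ℝ → ℂ → ℂ := fun s z => q (c + (lam s z : ℂ) * (z - c)) with hH
  have hnorm : ∀ z ∈ A, 0 < ‖z - c‖ := fun z hz => hr₁.trans_le hz.1
  have hlam_mem : ∀ s ∈ Icc (0 : ℝ) 1, ∀ z ∈ A, r₁ ≤ lam s z * ‖z - c‖ ∧ lam s z * ‖z - c‖ ≤ ‖z - c‖ := by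
    intro s hs z hz
    have hp := hnorm z hz
    have hq1 : r₁ / ‖z - c‖ ≤ 1 := (div_le_one hp).2 hz.1
    have hq0 : 0 < r₁ / ‖z - c‖ := div_pos hr₁ hp
    have e : lam s z * ‖z - c‖ = (1 - s) * ‖z - c‖ + s * r₁ := by
      simp only [hlam]; field_simp
    rw [e]
    constructor <;> nlinarith [hs.1, hs.2, hz.1]
  have hmemA : ∀ s ∈ Icc (0 : ℝ) 1, ∀ z ∈ A, c + (lam s z : ℂ) * (z - c) ∈ A := by
    intro s hs z hz
    have hl0 : 0 ≤ lam s z := by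
      have := (hlam_mem s hs z hz).1
      have hp := hnorm z hz
      nlinarith [hr₁]
    have e : ‖c + (lam s z : ℂ) * (z - c) - c‖ = lam s z * ‖z - c‖ := by
      rw [add_sub_cancel_left, norm_mul, Complex.norm_of_nonneg hl0]
    refine ⟨?_, ?_⟩
    · rw [e]; exact (hlam_mem s hs z hz).1
    · rw [e]; exact (hlam_mem s hs z hz).2.trans hz.2
  have hlamc : ContinuousOn (fun p : ℝ × ℂ => lam p.1 p.2) (Icc 0 1 ×ˢ A) := by
    simp only [hlam]
    refine ((continuousOn_const.sub continuousOn_fst).add (continuousOn_fst.mul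
      (continuousOn_const.div (continuous_norm.comp_continuousOn
        (continuousOn_snd.sub continuousOn_const)) fun p hp => (hnorm p.2 hp.2).ne')))
  have hHc : ContinuousOn (fun p : ℝ × ℂ => H p.1 p.2) (Icc 0 1 ×ˢ A) := by
    simp only [hH]
    refine hq.comp ((continuousOn_const.add ((continuous_ofReal.comp_continuousOn hlamc).mul
      (continuousOn_snd.sub continuousOn_const)))) fun p hp => hmemA p.1 hp.1 p.2 hp.2
  have h0 : ∀ z ∈ A, H 0 z = q z := by
    intro z _
    simp only [hH, hlam, sub_zero, zero_mul, add_zero, ofReal_one, one_mul, add_sub_cancel]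
  set ret : ℂ → ℂ := fun z => c + ((r₁ / ‖z - c‖ : ℝ) : ℂ) * (z - c) with hret
  have h1 : ∀ z ∈ A, H 1 z = q (ret z) := by
    intro z _
    simp only [hH, hlam, hret, sub_self, one_mul, zero_add]
  have hHne : ∀ s ∈ Icc (0 : ℝ) 1, ∀ z ∈ A, H s z ≠ 0 := fun s hs z hz =>
    hne _ (hmemA s hs z hz).1 (hmemA s hs z hz).2
  rw [hasLogOn_iff_of_homotopy H hHc h0 h1 hHne]
  -- `q ∘ ret` has the logarithm `L ∘ ret`
  have hsph : sphere c r₁ ⊆ A := fun z hz =>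
    ⟨(mem_sphere_iff_norm.1 hz).ge, (mem_sphere_iff_norm.1 hz).le.trans h12⟩
  obtain ⟨L, hLc, hLe⟩ := hasLogOn_sphere_of_wind_eq_zero hr₁ (hq.mono hsph)
    (fun z hz => hne z (mem_sphere_iff_norm.1 hz).ge ((mem_sphere_iff_norm.1 hz).le.trans h12)) hw
  have hret_mem : ∀ z ∈ A, ret z ∈ sphere c r₁ := by
    intro z hz
    have hp := hnorm z hz
    rw [mem_sphere_iff_norm, hret, add_sub_cancel_left, norm_mul,
      Complex.norm_of_nonneg (div_pos hr₁ hp).le, div_mul_cancel₀ _ hp.ne']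
  have hretc : ContinuousOn ret A := by
    simp only [hret]
    refine continuousOn_const.add ((continuous_ofReal.comp_continuousOn
      (continuousOn_const.div (continuous_norm.comp_continuousOn
        (continuousOn_id.sub continuousOn_const)) fun z hz => (hnorm z hz).ne')).mul
      (continuousOn_id.sub continuousOn_const))
  exact ⟨fun z => L (ret z), hLc.comp hretc hret_mem, fun z hz => hLe _ (hret_mem z hz)⟩

/-! ### Winding numbers of conjugate loops -/

/-- The loop `t ↦ |f t|²` of a loop in `ℂ \ {0}` has winding number `0` (it has the real periodic
logarithm `log |f|²`). [folklore] -/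
theorem wind_normSq {f : ℝ → ℂ} (hf : IsNonvanishingLoop f) :
    wind (fun t => ((normSq (f t) : ℝ) : ℂ)) = 0 := by
  have hl : ContinuousOn (fun t => ((Real.log (normSq (f t)) : ℝ) : ℂ)) (Icc 0 1) :=
    continuous_ofReal.comp_continuousOn ((continuous_normSq.comp_continuousOn hf.continuousOn).log
      fun t ht => (normSq_pos.2 (hf.ne_zero t ht)).ne')
  have h := wind_exp_eq_zero hl (by simp only [hf.eq_endpoints])
  rw [wind_congr (g := fun t => ((normSq (f t) : ℝ) : ℂ)) fun t ht => ?_] at h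
  · exact h
  · rw [← ofReal_exp, Real.exp_log (normSq_pos.2 (hf.ne_zero t ht))]

/-- **Conjugation reverses the winding number**: `wind (conj ∘ f) = - wind f`
(`conj w = |w|² · w⁻¹`). [folklore] -/
theorem wind_conj {f : ℝ → ℂ} (hf : IsNonvanishingLoop f) :
    wind (fun t => conj (f t)) = -wind f := by
  have hns : IsNonvanishingLoop fun t => ((normSq (f t) : ℝ) : ℂ) :=
    ⟨continuous_ofReal.comp_continuousOn (continuous_normSq.comp_continuousOn hf.continuousOn),
      fun t ht => by exact_mod_cast (normSq_pos.2 (hf.ne_zero t ht)).ne',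
      by simp only [hf.eq_endpoints]⟩
  rw [wind_congr (g := fun t => ((normSq (f t) : ℝ) : ℂ) * (f t)⁻¹) fun t ht => ?_,
    wind_mul hns hf.inv, wind_normSq hf, wind_inv hf, zero_add]
  have h0 : f t ≠ 0 := hf.ne_zero t ht
  rw [eq_mul_inv_iff_mul_eq₀ h0, mul_comm, mul_conj]

end Literature.Topology.PlaneTopology

end
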